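import Literature.AlgebraicGeometry.ModuliOfAbelianVarieties.SiegelFamilyProductLociHodgeGroupEllipticBlock
import Literature.AlgebraicGeometry.ModuliOfAbelianVarieties.SiegelFamilyScalarPointsEllipticPowers
import Literature.Geometry.Kaehler.ComplexTorusHodgeClassesProductHodgeGroup
import Literature.Geometry.Kaehler.ComplexTorusDivisorClassesIsogeny
import HarnessLib

/-!
# Hodge classes on the product locus `𝔥_{g₁} × 𝔥_{g₂} → 𝔥_g`: the Künneth count and Tate's `D = B` for `X_{(Z₁ 0; 0 Z₂)}`
# when `Hg(X_{Z₁} × X_{Z₂}) = Hg(X_{Z₁}) × Hg(X_{Z₂})` (Moonen–Zarhin (3.1); Gordon §3), e.g. a non-CM elliptic block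
# times a CM-type block

Layer `Literature/AlgebraicGeometry/ModuliOfAbelianVarieties`, namespace
`Literature.AlgebraicGeometry.ModuliOfAbelianVarieties.SiegelModuli`; lane `lit-hodgefound` (Track 2 foundations
library, Layers A1/A4 «Hodge groups and Hodge classes of the members of the Siegel family»), prover seat p17, generation 30,
self-proposed row g30-#15 — the HODGE-CLASS reading of g30-#3/g30-#9 on p11's product locus.  `X_{(Z₁ 0; 0 Z₂)} ≅ X_{Z₁} × X_{Z₂}`
(p11 `isIsogenous_prinPeriod_blockDiagPoint_prod`), and `dim_ℚ H^{2p}_Hodge`, `dim_ℚ Dᵖ` and the truth of `Dᵖ = H^{2p}_Hodge` are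
isogeny invariants (Lange Exercise 7.3.3 (1), the Kaehler layer's `IsIsogenous.finrank_hodgeClasses_eq`,
`IsIsogenous.divisorClasses_eq_hodgeClasses_iff`); so the Kaehler layer's Künneth machinery for `X₁ × X₂`
(`sum_finrank_hodgeClasses_mul_le` — always `≥` the Künneth count; `finrank_hodgeClasses_prod_eq_sum_of_prod_le_hodgeGroup` and
`forall_divisorClasses_prod_eq_hodgeClasses_of_prod_le_hodgeGroup` — equality and the transfer of `D = B` when
`Hg(X₁ × X₂) = Hg(X₁) × Hg(X₂)`, Moonen–Zarhin (3.1) / Gordon §3 / Murty) reads on `X_{(Z₁ 0; 0 Z₂)}`; g30-#9's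
`Hg(X_τ × X_Z) = Hg(X_τ) × Hg(X_Z)` (`τ ∈ 𝔥₁` non-CM, `Hg(X_Z)(ℂ)` commutative) gives the unconditional instance.  THEOREMS ONLY:
no definition, no instance, no named fact, nothing conditional (D-0026, net debt 0).

## Sources, verbatim

* B. Moonen, Yu. Zarhin, *Hodge classes on abelian varieties of low dimension*, Math. Ann. 315 (1999), §3 (3.1): «if
  `Hg(X₁ × X₂) = Hg(X₁) × Hg(X₂)` then `B•(X₁ × X₂) = B•(X₁) ⊗ B•(X₂)`»; §3 Theorem (2).
* B. B. Gordon, *A survey of the Hodge conjecture for abelian varieties* (1997/1999), §3 Theorem (second bullet) and its proof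
  («`Hdg(A) = Hdg(B) ⊗ Hdg(C) = Div(A)`»).
* H. Lange, *Abelian Varieties over the Complex Numbers* (2023), §7.3.3 Exercise (1)(a),(b) (isogeny invariance), Exercise (3)(a).
* C. Voisin, *Hodge Theory and Complex Algebraic Geometry I* (2002), §11.3.3 Thm. 11.38 (Künneth).
* B. van Geemen, *An introduction to the Hodge conjecture for abelian varieties* (1994), §2 (2.4), Thm. 4.3 (Tate).

## What is proved (`e : Fin g₁ ⊕ Fin g₂ ≃ Fin g`, `Zᵢ ∈ 𝔥_{gᵢ}`; for the instance `e : Fin 1 ⊕ Fin n ≃ Fin g`, `τ = Z₁ ∈ 𝔥₁`)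

* §1 `finrank_hodgeClasses_prinPeriod_blockDiagPoint` (`dim B^p(X_{(Z₁ 0; 0 Z₂)}) = dim B^p(X_{Z₁} × X_{Z₂})`),
  `finrank_divisorClasses_prinPeriod_blockDiagPoint`, `divisorClasses_prinPeriod_blockDiagPoint_eq_hodgeClasses_iff`
  (`D = B` on `X_{(Z₁ 0; 0 Z₂)}` iff on `X_{Z₁} × X_{Z₂}`), **`sum_finrank_hodgeClasses_mul_le_prinPeriod_blockDiagPoint`**
  (the Künneth count is a LOWER bound, always).
* §2 **`finrank_hodgeClasses_prinPeriod_blockDiagPoint_eq_sum_of_hodgeGroup_prod_eq`** (`= ` the Künneth count when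
  `Hg(X_{Z₁} × X_{Z₂}) = Hg × Hg`), **`divisorClasses_prinPeriod_blockDiagPoint_eq_hodgeClasses_of_hodgeGroup_prod_eq`** (then
  `D = B` on both blocks ⟹ `D = B` on `X_{(Z₁ 0; 0 Z₂)}`).
* §3 the instance: **`finrank_hodgeClasses_prinPeriod_blockDiagPoint_succ_of_not_isCMPoint`**
  (`dim B^{p+1}(X_{(τ 0; 0 Z)}) = dim B^{p+1}(X_Z) + dim B^p(X_Z)`: no exceptional Hodge classes), **`divisorClasses_prinPeriod_blockDiagPoint_eq_hodgeClasses_of_not_isCMPoint`**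
  (`D = B` on `X_Z` ⟹ `D = B` on `X_{(τ 0; 0 Z)}`), and the `IsTorusSubgroup` phrasings.

## Proof route / deviation

Isogeny invariance along `X_{(Z₁ 0; 0 Z₂)} ≅ X_{Z₁} × X_{Z₂}`, then the Kaehler layer by name; `D = B` on `X_τ`, `τ ∈ 𝔥₁`, is
g28/g29's `divisorClasses_prinPeriod_one_eq_hodgeClasses`, and the Hodge numbers of `X_τ` are those of `E_τ`
(`isIsogenous_prinPeriod_one_ellipticPeriod`).  No general position statement about `Hg` is made beyond the hypothesis.

## References

* [MoonenZarhin1999LowDim] B. Moonen, Yu. Zarhin, *Hodge classes on abelian varieties of low dimension*, Math. Ann. 315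
  (1999), §3 (3.1) and Theorem (2). [cite: MoonenZarhin1999LowDim, §3 (3.1)]
* [Gordon1997] B. B. Gordon, *A survey of the Hodge conjecture for abelian varieties*, §3 Theorem. [cite: Gordon1997, §3 Theorem (second bullet) and its proof]
* [Lange2023AbelianVarietiesComplex] H. Lange, *Abelian Varieties over the Complex Numbers*, Springer (2023), §7.3.3
  Exercise (1). [cite: Lange2023AbelianVarietiesComplex, §7.3.3 Exercise (1)(a), (b)]
* [VoisinHodgeI2002] C. Voisin, *Hodge Theory and Complex Algebraic Geometry I*, CUP (2002), §11.3.3 Thm. 11.38.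
  [cite: VoisinHodgeI2002, §11.3.3 Thm. 11.38 (PDF p. 236)]
* [vanGeemen1994HodgeAV] B. van Geemen, *An introduction to the Hodge conjecture for abelian varieties* (1994), §2 (2.4),
  Thm. 4.3. [cite: vanGeemen1994HodgeAV, §2 (2.4)]
-/

noncomputable section

open scoped Matrix Classical
open Matrix Function Set Module
open Finset.HasAntidiagonal (antidiagonal mem_antidiagonal)

namespace Literature.AlgebraicGeometry.ModuliOfAbelianVarieties

namespace SiegelModuli

open Literature.NumberTheory.Automorphic
open Literature.NumberTheory.ModularForms Literature.NumberTheory.ModularForms.SiegelUpperHalfSpace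
open Literature.NumberTheory.ComplexMultiplication Literature.NumberTheory.ComplexMultiplication.SiegelCMPoint
open Literature.Geometry.Kaehler Literature.Geometry.Kaehler.ComplexTorus

variable {g g₁ g₂ n : ℕ}

/-! ## §1 Isogeny invariance along `X_{(Z₁ 0; 0 Z₂)} ≅ X_{Z₁} × X_{Z₂}` -/

section Invariance

variable (e : Fin g₁ ⊕ Fin g₂ ≃ Fin g) (Z₁ : siegelUpperHalfSpace g₁) (Z₂ : siegelUpperHalfSpace g₂)

/-- **`dim_ℚ H^{2p}_Hodge(X_{(Z₁ 0; 0 Z₂)}) = dim_ℚ H^{2p}_Hodge(X_{Z₁} × X_{Z₂})`** (isogeny invariance, Exercise 7.3.3 (1)(a)).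
[cite: Lange2023AbelianVarietiesComplex, §7.3.3 Exercise (1)(a)] -/
theorem finrank_hodgeClasses_prinPeriod_blockDiagPoint (p : ℕ) :
    finrank ℚ (hodgeClasses (prinPeriod (blockDiagPoint e Z₁ Z₂)) p) =
      finrank ℚ (hodgeClasses (prodPeriod (prinPeriod Z₁) (prinPeriod Z₂)) p) :=
  (isIsogenous_prinPeriod_blockDiagPoint_prod e Z₁ Z₂).finrank_hodgeClasses_eq _ _ p

/-- **`dim_ℚ Dᵖ(X_{(Z₁ 0; 0 Z₂)}) = dim_ℚ Dᵖ(X_{Z₁} × X_{Z₂})`** (isogeny invariance of the divisor-class spaces).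
[cite: Lange2023AbelianVarietiesComplex, §7.3.3 Exercise (1)(a)] -/
theorem finrank_divisorClasses_prinPeriod_blockDiagPoint (p : ℕ) :
    finrank ℚ (divisorClasses (prinPeriod (blockDiagPoint e Z₁ Z₂)) p) =
      finrank ℚ (divisorClasses (prodPeriod (prinPeriod Z₁) (prinPeriod Z₂)) p) :=
  (isIsogenous_prinPeriod_blockDiagPoint_prod e Z₁ Z₂).finrank_divisorClasses_eq _ _ p

/-- **`Dᵖ = H^{2p}_Hodge` holds on `X_{(Z₁ 0; 0 Z₂)}` iff it holds on `X_{Z₁} × X_{Z₂}`** (Exercise 7.3.3 (1)(b): the Hodge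
`(p,p)` statement is an isogeny invariant). [cite: Lange2023AbelianVarietiesComplex, §7.3.3 Exercise (1)(b)] -/
theorem divisorClasses_prinPeriod_blockDiagPoint_eq_hodgeClasses_iff (p : ℕ) :
    divisorClasses (prinPeriod (blockDiagPoint e Z₁ Z₂)) p = hodgeClasses (prinPeriod (blockDiagPoint e Z₁ Z₂)) p ↔
      divisorClasses (prodPeriod (prinPeriod Z₁) (prinPeriod Z₂)) p =
        hodgeClasses (prodPeriod (prinPeriod Z₁) (prinPeriod Z₂)) p :=
  (isIsogenous_prinPeriod_blockDiagPoint_prod e Z₁ Z₂).divisorClasses_eq_hodgeClasses_iff _ _ p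

/-- **THE KÜNNETH COUNT IS A LOWER BOUND, ALWAYS: `dim B^p(X_{(Z₁ 0; 0 Z₂)}) ≥ Σ_{a+b=p} dim B^a(X_{Z₁}) · dim B^b(X_{Z₂})`**
(cross products of Hodge classes of the blocks are Hodge classes; Künneth injectivity). [cite: VoisinHodgeI2002, §11.3.3 Thm. 11.38 (PDF p. 236)]
[cite: vanGeemen1994HodgeAV, §2 (2.4)] -/
theorem sum_finrank_hodgeClasses_mul_le_prinPeriod_blockDiagPoint (p : ℕ) :
    ∑ ab ∈ antidiagonal p,
        finrank ℚ (hodgeClasses (prinPeriod Z₁) ab.1) * finrank ℚ (hodgeClasses (prinPeriod Z₂) ab.2) ≤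
      finrank ℚ (hodgeClasses (prinPeriod (blockDiagPoint e Z₁ Z₂)) p) := by
  rw [finrank_hodgeClasses_prinPeriod_blockDiagPoint]
  exact sum_finrank_hodgeClasses_mul_le _ _ p

end Invariance

/-! ## §2 When `Hg(X_{Z₁} × X_{Z₂}) = Hg(X_{Z₁}) × Hg(X_{Z₂})`: the Künneth count is attained and `D = B` transfers -/

section ProductHodgeGroup

variable (e : Fin g₁ ⊕ Fin g₂ ≃ Fin g) (Z₁ : siegelUpperHalfSpace g₁) (Z₂ : siegelUpperHalfSpace g₂)

/-- **MOONEN–ZARHIN (3.1) ON THE PRODUCT LOCUS: if `Hg(X_{Z₁} × X_{Z₂}) = Hg(X_{Z₁}) × Hg(X_{Z₂})` then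
`dim B^p(X_{(Z₁ 0; 0 Z₂)}) = Σ_{a+b=p} dim B^a(X_{Z₁}) · dim B^b(X_{Z₂})`** — no exceptional Hodge classes on `X_{(Z₁ 0; 0 Z₂)}`.
[cite: MoonenZarhin1999LowDim, §3 (3.1)] [cite: Gordon1997, §3 Theorem (proof)] -/
theorem finrank_hodgeClasses_prinPeriod_blockDiagPoint_eq_sum_of_hodgeGroup_prod_eq
    (hprod : hodgeGroup (prodPeriod (prinPeriod Z₁) (prinPeriod Z₂)) =
      ((hodgeGroup (prinPeriod Z₁)).prod (hodgeGroup (prinPeriod Z₂))).map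
        (ComplexTorus.blockDiag (Fin g₁ ⊕ Fin g₁) (Fin g₂ ⊕ Fin g₂))) (p : ℕ) :
    finrank ℚ (hodgeClasses (prinPeriod (blockDiagPoint e Z₁ Z₂)) p) =
      ∑ ab ∈ antidiagonal p,
        finrank ℚ (hodgeClasses (prinPeriod Z₁) ab.1) * finrank ℚ (hodgeClasses (prinPeriod Z₂) ab.2) := by
  rw [finrank_hodgeClasses_prinPeriod_blockDiagPoint]
  exact finrank_hodgeClasses_prod_eq_sum_of_prod_le_hodgeGroup _ _ hprod.ge p

/-- **GORDON §3 / MURTY ON THE PRODUCT LOCUS: `Hg(X_{Z₁} × X_{Z₂}) = Hg × Hg` and `D = B` on both blocks (up to codimension `p`)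
⟹ `Dᵖ(X_{(Z₁ 0; 0 Z₂)}) = H^{2p}_Hodge(X_{(Z₁ 0; 0 Z₂)})`.** [cite: Gordon1997, §3 Theorem (second bullet) and its proof]
[cite: MoonenZarhin1999LowDim, §3 (3.1)] [cite: vanGeemen1994HodgeAV, §2 (2.4)] -/
theorem divisorClasses_prinPeriod_blockDiagPoint_eq_hodgeClasses_of_hodgeGroup_prod_eq
    (hprod : hodgeGroup (prodPeriod (prinPeriod Z₁) (prinPeriod Z₂)) =
      ((hodgeGroup (prinPeriod Z₁)).prod (hodgeGroup (prinPeriod Z₂))).map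
        (ComplexTorus.blockDiag (Fin g₁ ⊕ Fin g₁) (Fin g₂ ⊕ Fin g₂))) {p : ℕ}
    (h₁ : ∀ a ≤ p, divisorClasses (prinPeriod Z₁) a = hodgeClasses (prinPeriod Z₁) a)
    (h₂ : ∀ b ≤ p, divisorClasses (prinPeriod Z₂) b = hodgeClasses (prinPeriod Z₂) b) :
    divisorClasses (prinPeriod (blockDiagPoint e Z₁ Z₂)) p = hodgeClasses (prinPeriod (blockDiagPoint e Z₁ Z₂)) p :=
  (divisorClasses_prinPeriod_blockDiagPoint_eq_hodgeClasses_iff e Z₁ Z₂ p).2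
    (divisorClasses_prod_eq_hodgeClasses_of_prod_le_hodgeGroup _ _ hprod.ge h₁ h₂)

/-- All codimensions at once. [cite: Gordon1997, §3 Theorem (second bullet) and its proof] [cite: MoonenZarhin1999LowDim, §3 (3.1)] -/
theorem forall_divisorClasses_prinPeriod_blockDiagPoint_eq_hodgeClasses_of_hodgeGroup_prod_eq
    (hprod : hodgeGroup (prodPeriod (prinPeriod Z₁) (prinPeriod Z₂)) =
      ((hodgeGroup (prinPeriod Z₁)).prod (hodgeGroup (prinPeriod Z₂))).map
        (ComplexTorus.blockDiag (Fin g₁ ⊕ Fin g₁) (Fin g₂ ⊕ Fin g₂)))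
    (h₁ : ∀ a, divisorClasses (prinPeriod Z₁) a = hodgeClasses (prinPeriod Z₁) a)
    (h₂ : ∀ b, divisorClasses (prinPeriod Z₂) b = hodgeClasses (prinPeriod Z₂) b) (p : ℕ) :
    divisorClasses (prinPeriod (blockDiagPoint e Z₁ Z₂)) p = hodgeClasses (prinPeriod (blockDiagPoint e Z₁ Z₂)) p :=
  divisorClasses_prinPeriod_blockDiagPoint_eq_hodgeClasses_of_hodgeGroup_prod_eq e Z₁ Z₂ hprod (fun a _ ↦ h₁ a)
    fun b _ ↦ h₂ b

end ProductHodgeGroup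

/-! ## §3 The instance `𝔥₁ × 𝔥_n → 𝔥_{1+n}`: a non-CM elliptic block `τ` and a CM-type block `Z` -/

section EllipticBlock

variable (e : Fin 1 ⊕ Fin n ≃ Fin g) (Z₁ : siegelUpperHalfSpace 1) (Z₂ : siegelUpperHalfSpace n)

/-- The Hodge numbers of the elliptic block: `dim B⁰(X_τ) = 1`. [cite: Lange2023AbelianVarietiesComplex, §7.2.2] -/
theorem finrank_hodgeClasses_prinPeriod_one_zero : finrank ℚ (hodgeClasses (prinPeriod Z₁) 0) = 1 := by
  rw [(isIsogenous_prinPeriod_one_ellipticPeriod Z₁).finrank_hodgeClasses_eq, finrank_hodgeClasses_zero_of_rank_two]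

/-- `dim B¹(X_τ) = 1` (`ρ(E) = 1`). [cite: Lange2023AbelianVarietiesComplex, §7.2.2] -/
theorem finrank_hodgeClasses_prinPeriod_one_one : finrank ℚ (hodgeClasses (prinPeriod Z₁) 1) = 1 := by
  rw [(isIsogenous_prinPeriod_one_ellipticPeriod Z₁).finrank_hodgeClasses_eq, finrank_hodgeClasses_one_of_rank_two]

/-- `dim B^{a+2}(X_τ) = 0`. [cite: Lange2023AbelianVarietiesComplex, §7.2.2] -/
theorem finrank_hodgeClasses_prinPeriod_one_add_two (a : ℕ) : finrank ℚ (hodgeClasses (prinPeriod Z₁) (a + 2)) = 0 := by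
  rw [(isIsogenous_prinPeriod_one_ellipticPeriod Z₁).finrank_hodgeClasses_eq, finrank_hodgeClasses_add_two_of_rank_two]

/-- **NO EXCEPTIONAL HODGE CLASSES ON `X_{(τ 0; 0 Z)}` FOR `τ` NON-CM AND `Hg(X_Z)(ℂ)` COMMUTATIVE:
`dim_ℚ H^{2p+2}_Hodge(X_{(τ 0; 0 Z)}) = dim_ℚ H^{2p+2}_Hodge(X_Z) + dim_ℚ H^{2p}_Hodge(X_Z)`** (g30-#9's `Hg(X_τ × X_Z) = Hg(X_τ) × Hg(X_Z)`
fed into (3.1)). [cite: MoonenZarhin1999LowDim, §3 Theorem (2) and (3.1)] [cite: Imai1976HodgeGroups, §2 Proposition (pp. 368, 370)] -/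
theorem finrank_hodgeClasses_prinPeriod_blockDiagPoint_succ_of_not_isCMPoint (hτ : ¬ IsCMPoint Z₁)
    (hc : ∀ M ∈ hodgeGroupC (prinPeriod Z₂), ∀ N ∈ hodgeGroupC (prinPeriod Z₂), M * N = N * M) (p : ℕ) :
    finrank ℚ (hodgeClasses (prinPeriod (blockDiagPoint e Z₁ Z₂)) (p + 1)) =
      finrank ℚ (hodgeClasses (prinPeriod Z₂) (p + 1)) + finrank ℚ (hodgeClasses (prinPeriod Z₂) p) := by
  rw [finrank_hodgeClasses_prinPeriod_blockDiagPoint_eq_sum_of_hodgeGroup_prod_eq e Z₁ Z₂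
    (hodgeGroup_prod_prinPeriod_one_eq_of_not_isCMPoint Z₁ Z₂ hτ hc) (p + 1),
    Finset.Nat.sum_antidiagonal_eq_sum_range_succ_mk, Finset.sum_range_succ', Finset.sum_range_succ',
    finrank_hodgeClasses_prinPeriod_one_zero, finrank_hodgeClasses_prinPeriod_one_one, one_mul, one_mul,
    Finset.sum_eq_zero fun k _ ↦ by rw [finrank_hodgeClasses_prinPeriod_one_add_two, zero_mul]]
  rw [show p + 1 - (0 + 1) = p by omega, Nat.sub_zero, zero_add, add_comm]

/-- The same with «`MT(X_Z)(ℂ)` is a torus». [cite: MoonenZarhin1999LowDim, §3 Theorem (2) and (3.1)] [cite: Gordon1997, §2 Prop. 2.12] -/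
theorem finrank_hodgeClasses_prinPeriod_blockDiagPoint_succ_of_not_isCMPoint_of_isTorusSubgroup (hτ : ¬ IsCMPoint Z₁)
    (hT : IsTorusSubgroup (mumfordTateGroupC (prinPeriod Z₂))) (p : ℕ) :
    finrank ℚ (hodgeClasses (prinPeriod (blockDiagPoint e Z₁ Z₂)) (p + 1)) =
      finrank ℚ (hodgeClasses (prinPeriod Z₂) (p + 1)) + finrank ℚ (hodgeClasses (prinPeriod Z₂) p) :=
  finrank_hodgeClasses_prinPeriod_blockDiagPoint_succ_of_not_isCMPoint e Z₁ Z₂ hτ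
    ((Set.ext_iff.1 (setOf_isTorusSubgroup_mumfordTateGroupC_eq_setOf_hodgeGroupC_comm n) Z₂).1 hT) p

/-- **`D = B` ON `X_Z` ⟹ `D = B` ON `X_{(τ 0; 0 Z)}`** for `τ ∈ 𝔥₁` non-CM and `Hg(X_Z)(ℂ)` commutative (on the elliptic block `D = B`
always, `divisorClasses_prinPeriod_one_eq_hodgeClasses`): a known-cases transfer of the Hodge `(p,p)` statement along the
product locus. [cite: Gordon1997, §3 Theorem (second bullet) and its proof] [cite: MoonenZarhin1999LowDim, §3 Theorem (2) and (3.1)] -/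
theorem divisorClasses_prinPeriod_blockDiagPoint_eq_hodgeClasses_of_not_isCMPoint (hτ : ¬ IsCMPoint Z₁)
    (hc : ∀ M ∈ hodgeGroupC (prinPeriod Z₂), ∀ N ∈ hodgeGroupC (prinPeriod Z₂), M * N = N * M)
    (h₂ : ∀ b, divisorClasses (prinPeriod Z₂) b = hodgeClasses (prinPeriod Z₂) b) (p : ℕ) :
    divisorClasses (prinPeriod (blockDiagPoint e Z₁ Z₂)) p = hodgeClasses (prinPeriod (blockDiagPoint e Z₁ Z₂)) p :=
  forall_divisorClasses_prinPeriod_blockDiagPoint_eq_hodgeClasses_of_hodgeGroup_prod_eq e Z₁ Z₂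
    (hodgeGroup_prod_prinPeriod_one_eq_of_not_isCMPoint Z₁ Z₂ hτ hc) (divisorClasses_prinPeriod_one_eq_hodgeClasses Z₁) h₂ p

/-- The same with «`MT(X_Z)(ℂ)` is a torus». [cite: Gordon1997, §3 Theorem (second bullet) and §2 Prop. 2.12]
[cite: MoonenZarhin1999LowDim, §3 Theorem (2) and (3.1)] -/
theorem divisorClasses_prinPeriod_blockDiagPoint_eq_hodgeClasses_of_not_isCMPoint_of_isTorusSubgroup (hτ : ¬ IsCMPoint Z₁)
    (hT : IsTorusSubgroup (mumfordTateGroupC (prinPeriod Z₂)))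
    (h₂ : ∀ b, divisorClasses (prinPeriod Z₂) b = hodgeClasses (prinPeriod Z₂) b) (p : ℕ) :
    divisorClasses (prinPeriod (blockDiagPoint e Z₁ Z₂)) p = hodgeClasses (prinPeriod (blockDiagPoint e Z₁ Z₂)) p :=
  divisorClasses_prinPeriod_blockDiagPoint_eq_hodgeClasses_of_not_isCMPoint e Z₁ Z₂ hτ
    ((Set.ext_iff.1 (setOf_isTorusSubgroup_mumfordTateGroupC_eq_setOf_hodgeGroupC_comm n) Z₂).1 hT) h₂ p

end EllipticBlock

end SiegelModuli

end Literature.AlgebraicGeometry.ModuliOfAbelianVarieties
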